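import HarnessLib
import Summits.HodgeConjecture.HodgeConjecture.Cruxes.H413.Lines.K2_E3_EllipticInputs
import Literature.NumberTheory.Automorphic.LocalIrrepAdmissible
import Summits.HodgeConjecture.HodgeConjecture.Theorems.K2E3CharLocConstOnRegularSetOfLocal
import Summits.HodgeConjecture.HodgeConjecture.Theorems.K2E3CharLocIntOfLocal
import Summits.HodgeConjecture.HodgeConjecture.Theorems.K2E3CharLocBddOfLocal
import Summits.HodgeConjecture.HodgeConjecture.Theorems.K2E3NormalizedCharBddNearSemisimpleDescent
import Summits.HodgeConjecture.HodgeConjecture.Theorems.K2E3OrbitClosureContainsSemisimple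
import Summits.HodgeConjecture.HodgeConjecture.Theorems.K2E3CayleySliceConjugatesNhds
import Summits.HodgeConjecture.HodgeConjecture.Theorems.K2E3CharLocConstNearRegular
import Summits.HodgeConjecture.HodgeConjecture.Theorems.K2E3CharLocIntNearSemisimpleSupercuspidalOfTruncated
import Summits.HodgeConjecture.HodgeConjecture.Theorems.K2E3NormalizedCharBddOnCayleySliceOfLieCoreFixed
import Summits.HodgeConjecture.HodgeConjecture.Theorems.K2E3GL2NilpotentFourierRegularOfStructure
import Summits.HodgeConjecture.HodgeConjecture.Theorems.K2E3LocalIrrepAdmissibleQuasiSplit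
import Summits.HodgeConjecture.HodgeConjecture.Theorems.K2E3LocalIrrepAdmissibleAnyKernel
import Summits.HodgeConjecture.HodgeConjecture.Theorems.K2E3CharLocIntIrreduciblePrincipalSeries
import Summits.HodgeConjecture.HodgeConjecture.Theorems.K2E3CharLocIntSteinbergClasses
import Summits.HodgeConjecture.HodgeConjecture.Theorems.K2E3CharLocIntNearModelTransport
import Summits.HodgeConjecture.HodgeConjecture.Theorems.F0P3bNonsplitIdentification
import Summits.HodgeConjecture.HodgeConjecture.Theorems.K2E3LocalIrrepCuspidalOrPrincipalThree
import Summits.HodgeConjecture.HodgeConjecture.Theorems.K2E3GL2RegularNilpotentFourier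
import Summits.HodgeConjecture.HodgeConjecture.Theorems.K2E3GL2NilpotentOneOrbitUniqueness
import Summits.HodgeConjecture.HodgeConjecture.Theorems.K2E3U2NilpotentFourierRegularOfGL2
import Summits.HodgeConjecture.HodgeConjecture.Theorems.K2E3U01NilpotentFourierRegular
import Summits.HodgeConjecture.HodgeConjecture.Theorems.K2E3GL2NmNilpotentFourierRegularOfTwistedLocal
import Summits.HodgeConjecture.HodgeConjecture.Theorems.K2E3GL3NilpotentFourierRegularOfSliceDensities
import Summits.HodgeConjecture.HodgeConjecture.Theorems.K2E3NormalizedCharBddNearSingularDescentLeTwo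
import Summits.HodgeConjecture.HodgeConjecture.Theorems.K2E3GL2TwistedRegularNilpotentFourier
import Summits.HodgeConjecture.HodgeConjecture.Theorems.K2E3GL3BorelSliceDensity
import Summits.HodgeConjecture.HodgeConjecture.Theorems.K2E3GL3ParabolicSliceDensity
import Summits.HodgeConjecture.HodgeConjecture.Theorems.K2E3GL3SupercuspidalCharLocInt
import Summits.HodgeConjecture.HodgeConjecture.Theorems.K2E3GL3ModUniformizerNonEllEstimates
import Summits.HodgeConjecture.HodgeConjecture.Theorems.K2E3CharLocIntNearSplitSupercuspidalTransport
import Literature.NumberTheory.Automorphic.AnisotropicUnitaryGroupCompactLocal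
import Summits.HodgeConjecture.HodgeConjecture.Theorems.K2E3CharLocIntNearSplitNonSupercuspidalTransport
import Summits.HodgeConjecture.HodgeConjecture.Theorems.K2E3CharLocIntNearParabolicIndOfAC
import Summits.HodgeConjecture.HodgeConjecture.Theorems.K2E3CharLocIntNearLinearCombination
import Summits.HodgeConjecture.HodgeConjecture.Theorems.K2E3GL3ParabolicKMUAbsCont
import Summits.HodgeConjecture.HodgeConjecture.Theorems.K2E3GL3BorelKMUAbsCont
import Literature.NumberTheory.Automorphic.ParabolicInductionSupercuspidalProofs
import Summits.HodgeConjecture.HodgeConjecture.Theorems.K2E3FinConjPlaceOfFinConj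
import Literature.NumberTheory.Automorphic.IrreducibleClassesConstituents
import Summits.HodgeConjecture.HodgeConjecture.Theorems.K2E3ULieCharExpansionAtOneLeOne    -- ED. 2: ★ p861672 (K2E3-p28 (g2)) pays (LAU-le1)
import Summits.HodgeConjecture.HodgeConjecture.Cruxes.H413.Lines.K2_E3_EllipticInputsSigs_Lie3b    -- ED. 3: PART «LIE3b» ED. 2 (K2E3-typ4 (g0)): per-N heads re-prove (LAU-2)/(LAU-3) over (LAU-dist-2)/(LAU-dist-3) + ★ (LAU-fin)/(LAU-pt); imports no sig PART (no cycle)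
-- import block = PART «LIE» (tree sha16 ab77c5ccccbbc4a5) import TARGETS verbatim, comments stripped; this PART does NOT import «LIE» (no socket below needs a «LIE» decl) and «LIE» does not
-- import this PART until the dealer's tie edition (K2E3-plan g4) re-ties (L-A_U)′ «LIE» :401 over the four sockets below by the `N ≤ 1 ∣ N = 2 ∣ N = 3 ∣ N ≥ 4` split.

/-!
# K2_E3_EllipticInputs ∕ U12Characters — PART «LIEA3» (tier 1): the (L-A_U)′ socket «LIE» :401 CUT BY `N` — the `N ≤ 1`, `N = 2`, `N = 3` LETTERS and the `N ≥ 4` REMAINDER, hosted apart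
(SAME namespace `Summit.HodgeConjecture.HodgeConjecture.Cruxes.H413.K2E3EllipticInputs.U12Characters`; new decl names; «LIE» is the dealer's chain — this PART is
K2E3-typ2's own file, dealer K2E3-plan (g4) 2026-09-04T15:01:30Z «(L-A_U)′@N ≤ 3 letters»).

WHY (K2E3-typ2 g0, ED. 1, 2026-09-04; strike line L4 `stub_StCharTS`, CLOSE-OUT DAY «N ≤ 3 cut»).  (L-A_U)′ `sig_K2E3ULieCharExpansionAtOne` («LIE» :401) is Harish-Chandra's LOCAL CHARACTER
EXPANSION AT `1` in `T̂`-form for the unitary group `U(σ_w,H_w)(L_w)` at a non-split place (`Θ_π(c(Y)) = F_T(Y)` on a neighbourhood of `0` in `𝔲`, `T ∈ J(𝒩)`, `c` the Cayley chart), quantified over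
EVERY `N`; it is OPEN XL with no road in tree, and it is ON the `stub_StCharTS` cone only through its `N ≤ 3` instances (tier-0 PRICE FLAG (i); dealer's «N ≤ 3 CLOSE-OUT CENSUS» row :401
«ON (∀ N as typed; N ≤ 3 instance needed), XL, UNMANNED»).  This PART cuts it BY `N` exactly as (L-B_U)′ was re-cut («LIE» ED. 14: (LBU-01) ★ ∕ `N = 2` ★ ∕ (LBU-ge3)) and (LBU-ge3)∕(12D-ge3) were
cut again (PART «LIE3»), so that the three `N ≤ 3` instances become NAMED, `Fin N`-concrete LETTERS for the L4 fan and the `N ≥ 4` remainder is visibly GENERALITY: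
* **(LAU-le1) `sig_K2E3ULieCharExpansionAtOneLeOne`** — `N ≤ 1`: `U(σ_w,H_w)(L_w)` is compact (`N = 1`: the norm-one torus; `N = 0`: trivial), every admissible irreducible `π` is
  finite-dimensional, `Θ_π = dim π` near `1`, `T := dim π · δ₀ ∈ J(𝒩)` (`𝒩 = {0}`), `T̂ = dim π`; statement = (L-A_U)′ text with the binder `(N : ℕ) (H : …)` ↦ `(N : ℕ), N ≤ 1 → ∀ (H : …)`
  (the (LBU-01) phrasing, token for token); size S–M, payable in-house on the ★ finite-dimensional capital (`K2E3GLnLieCharExpansionAtOneFinDim` §1–§3 is the `GL` template: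
  `cayley_mem_nhds_one`, `apply_eq_of_repr_fourier_pointSupport`, `lieCharExpansionAtOne_of_finite`; (LBU-01)'s payers `K2E3LieUnitaryNilpotentFourierRegularOfPointSupport` ∕
  `K2E3U01NilpotentFourierRegular` are the `𝔲`-side point-support kit);
* **(LAU-2) `sig_K2E3ULieCharExpansionAtOneTwo`** — `N = 2`: the expansion at `1` for quasi-split `U(1,1)` ∕ anisotropic `U(2)` (three nilpotent orbit types `{0}`, and the regular
  nilpotent `U`-orbits in `𝔲(1,1)`; none but `0` for anisotropic `H`); statement = (L-A_U)′ text, binder deleted, `N ↦ 2`; size L–XL (Harish-Chandra Thm. 16.3 at rank one; a road through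
  the `GL₂(L⁺_v)`-side ★ (LBGL-2a∕2b) + the norm-one descent used for (LBU-2⁺) is plausible but untyped);
* **(LAU-3) `sig_K2E3ULieCharExpansionAtOneThree`** — `N = 3`: the expansion at `1` for `U(3)` ∕ `U(2,1)` (Rogawski's group); statement = (L-A_U)′ text, binder deleted, `N ↦ 3`; size XL
  (Harish-Chandra Thm. 16.3; the ONE rank-two instance on the cone);
* **(LAU-ge4) `sig_K2E3ULieCharExpansionAtOneGeFour`** — the same text under `4 ≤ N` (binder ↦ `(N : ℕ), 4 ≤ N → ∀ (H : …)`); OPEN XL GENERALITY: the tier-0 organ instantiates (L-A_U)′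
  only at `N ≤ 3`, so this remainder has no consumer on the `stub_StCharTS` cone; count-neutral residue, like (LBGL-ge4) «LIE» :237 and (LBU-ge4)∕(12D-ge4) of PART «LIE3».
Statement bytes: bracket-extracted from «LIE» tree sha16 ab77c5ccccbbc4a5 by the generator `K2/K2E3-typ2/g0/mk_lieA3_ed1.py` (asserts: the binder occurs once; token-`N` count
preserved as `2` ∕ `3`; (le1)∕(ge4) == (L-A_U)′ text up to the one binder edit; (le1) first line == (LBU-01) first line; block prefix = «LIE»'s (LBU-ge3) prefix verbatim; 4 sorries;
no `instance` ∕ `notation` ∕ `axiom`; no banned option).  The dealer's tie («LIE» ED. next, K2E3-plan g4's chain; pre-checked sorry-free in `K2/K2E3-typ2/g0/probe_lieA3_tie.scratch.lean`):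
`intro L _ _ _ N; rcases Nat.lt_or_ge N 2 with h | h; · exact sig_…LeOne L N (by omega); · rcases Nat.eq_or_lt_of_le h with rfl | h3; · exact sig_…Two L;
· rcases Nat.eq_or_lt_of_le h3 with rfl | h4; · exact sig_…Three L; · exact sig_…GeFour L N h4`.  Payers conclude a socket BY NAME from `Theorems/…`
(`--supports stmt-HodgeConjecture-24833 --as helper`), never importing `Lines`.  Sorries in THIS file = 1 = {(LAU-ge4)} (ED. 3; ED. 1 had 4 — (LAU-le1) is ★-tied (ED. 2), (LAU-2)/(LAU-3) are tied over PART «LIE3b» (ED. 3), whose (LAU-dist-2)/(LAU-dist-3) sockets carry them).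

HONEST LABEL: HC_CM is proved only modulo the 7 printed citations (2 remaining named inputs: hLiu418 = stmt-HodgeConjecture-24832, h413 = stmt-HodgeConjecture-24833) until rung 0
closes; a hosted socket is a by-name debt; REL ≠ ★ ≠ BUILT.  ACCOUNTING at the dealer's tie edition: «LIE» (L-A_U)′ → REL over EXACTLY {(LAU-le1), (LAU-2), (LAU-3), (LAU-ge4)} (E3 Lines +3:
finer named currency; on the `N ≤ 3` cone the open (L-A_U)′ debt is then exactly {(LAU-le1) until paid, (LAU-2), (LAU-3)}).

§ EDITIONS (this PART).  ED. 1 (K2E3-typ2 g0; generator `K2/K2E3-typ2/g0/mk_lieA3_ed1.py`; source «LIE» tree sha16 ab77c5ccccbbc4a5): created.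
ED. 2 (K2E3-typ2 g0; generator `mk_lieA3_ed2.py`, base ED. 1 sha16 321f12f2244c5c8e): (LAU-le1) TIED `:= K2E3ULieCharExpansionAtOneLeOne.uLieCharExpansionAtOne_le_one` (★ p861672, K2E3-p28 (g2): every admissible irreducible of the compact `U(σ_w,H_w)(L_w)`, `N ≤ 1`, is finite-dimensional, then ★ p861546 (LAU-fin)); statement bytes of all four sockets unchanged; sorries 4 → 3 = {(LAU-2), (LAU-3), (LAU-ge4)}.
ED. 3 (K2E3-typ2 g0; generator `mk_lieA3_ed3.py`, base ED. 2 sha16 276e1eef8d8b2d41): (LAU-2) TIED `:= uLieCharExpansionAtOneTwo_of_sigs`, (LAU-3) TIED `:= uLieCharExpansionAtOneThree_of_sigs` (PART «LIE3b» ED. 2 per-`N` heads, K2E3-typ4 (g0): Harish-Chandra's germ-expansion road `by_cases Module.Finite` — finite-dimensional ★ (LAU-fin) p861546, else the distribution letter (LAU-dist-2)/(LAU-dist-3) + ★ (LAU-pt) p861596 — so the (L-A_U)′ content at `N = 2, 3` now lives in LIE3b's (LAU-dist-2)/(LAU-dist-3) sockets); statement bytes of all four sockets unchanged; sorries 3 →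 1 = {(LAU-ge4)} (GEN, off the `stub_StCharTS` cone).
-/

noncomputable section

open NumberField IsDedekindDomain MeasureTheory
open scoped Matrix MatrixGroups Valued NNReal
open Literature.NumberTheory.Rogawski1990 Literature.NumberTheory.Automorphic Literature.NumberTheory.Automorphic.UnitaryGroup
open Literature.NumberTheory.Automorphic.UnitaryGroup.CotangentForms Literature.NumberTheory.GaloisRepresentations
open Literature.NumberTheory.Automorphic.Arthur2013.Leaves.TECR
open Summit.HodgeConjecture.HodgeConjecture.Cruxes.H413.F0P3cStCharTSPaydown

namespace Summit.HodgeConjecture.HodgeConjecture.Cruxes.H413.K2E3EllipticInputs.U12Characters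

/-! ## §LA (ED. 1) — (L-A_U)′ of PART «LIE» cut BY `N`: the `N ≤ 1`, `N = 2`, `N = 3` letters and the `N ≥ 4` remainder -/

set_option maxHeartbeats 1600000 in
set_option synthInstance.maxHeartbeats 400000 in
open scoped Classical in
open MeasureTheory.Measure Filter Topology Polynomial Literature.NumberTheory.GaloisRepresentations.IsNonarchimedeanLocalField Summit.HodgeConjecture.HodgeConjecture.Cruxes.H413.K2E3LieUnitary in
/-- **LEAF (LAU-le1) `sig_K2E3ULieCharExpansionAtOneLeOne`** — (L-A_U)′ AT `N ≤ 1`: the local character expansion at `1` in `T̂`-form for the COMPACT group `U(σ_w,H_w)(L_w)`, `N ≤ 1` — every admissible irreducible `π` is finite-dimensional, `Θ_π = dim π` near `1`, `T := dim π · δ₀`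
(= (L-A_U)′ «LIE» :401 text with `(N : ℕ), N ≤ 1 → ∀ (H : …)`, the (LBU-01) phrasing; size S–M; payable in-house on the ★ finite-dimensional ∕ point-support capital). [cite: HarishChandra1999AdmissibleDistributions, Thm. 16.3 p. 77, §21 p. 87] [cite: Howe1974, Prop. 3]
ED. 1 (K2E3-typ2 g0, 2026-09-04): HOSTED LEAF — statement bytes = the cut described in the module docstring, from «LIE» (L-A_U)′ :401, tree sha16 ab77c5ccccbbc4a5 (generator `mk_lieA3_ed1.py`).  OPEN (payer files `Theorems/…lean --supports stmt-HodgeConjecture-24833 --as helper`, never importing `Lines`).  ED. 2: TIED ★ p861672 `K2E3ULieCharExpansionAtOneLeOne.uLieCharExpansionAtOne_le_one` (K2E3-p28 (g2)).  STATE: CLOSED ★. -/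
theorem sig_K2E3ULieCharExpansionAtOneLeOne :
    ∀ (L : Type) [Field L] [NumberField L] [IsCMField L] (N : ℕ), N ≤ 1 → ∀ (H : Matrix (Fin N) (Fin N) L),
      (H.map (cmConjRingHom L))ᵀ = H → H.det ≠ 0 →
      ∀ (v : HeightOneSpectrum (𝓞 ↥(maximalRealSubfield L))) (w : UnitaryGroup.PlacesOver L v) (hw : IsCMField.complexConj L • w.1 = w.1)
      (ψ : AddChar (w.1.adicCompletion L) Circle), ψ.IsContinuousNontrivial →
      (∃ a : w.1.adicCompletion L, galAdicCompletionMap (L := L) (IsCMField.complexConj L) hw a = a ∧ ψ a ≠ 1) →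
      ∀ [MeasurableSpace ↥(lieOfForm (galAdicCompletionMap (L := L) (IsCMField.complexConj L) hw) (UnitaryGroup.placeForm H w.1))]
        [BorelSpace ↥(lieOfForm (galAdicCompletionMap (L := L) (IsCMField.complexConj L) hw) (UnitaryGroup.placeForm H w.1))]
        (μ𝔤 : Measure ↥(lieOfForm (galAdicCompletionMap (L := L) (IsCMField.complexConj L) hw) (UnitaryGroup.placeForm H w.1))) [μ𝔤.IsAddHaarMeasure]
        [MeasurableSpace ↥(unitaryGroupOfForm (galAdicCompletionMap (L := L) (IsCMField.complexConj L) hw) (UnitaryGroup.placeForm H w.1))]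
        [BorelSpace ↥(unitaryGroupOfForm (galAdicCompletionMap (L := L) (IsCMField.complexConj L) hw) (UnitaryGroup.placeForm H w.1))]
        (μ₀ : Measure ↥(unitaryGroupOfForm (galAdicCompletionMap (L := L) (IsCMField.complexConj L) hw) (UnitaryGroup.placeForm H w.1))) [μ₀.IsHaarMeasure]
        (r₀ : SmoothIrrep ↥(unitaryGroupOfForm (galAdicCompletionMap (L := L) (IsCMField.complexConj L) hw) (UnitaryGroup.placeForm H w.1))), r₀.ρ.IsAdmissible →
        ∀ Θ₀ : ↥(unitaryGroupOfForm (galAdicCompletionMap (L := L) (IsCMField.complexConj L) hw) (UnitaryGroup.placeForm H w.1)) → ℂ,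
        (∀ x₀ : ↥(unitaryGroupOfForm (galAdicCompletionMap (L := L) (IsCMField.complexConj L) hw) (UnitaryGroup.placeForm H w.1)),
          IsRegularElt (x₀ : GL (Fin N) (w.1.adicCompletion L)) → ∀ᶠ y in 𝓝 x₀, Θ₀ y = Θ₀ x₀) →
        (∀ φ₀ : ↥(unitaryGroupOfForm (galAdicCompletionMap (L := L) (IsCMField.complexConj L) hw) (UnitaryGroup.placeForm H w.1)) → ℂ,
          IsLocSmooth φ₀ → (IrrClass.mk r₀).smoothTrace μ₀ φ₀ = ∫ x, φ₀ x * Θ₀ x ∂μ₀) →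
      ∃ V : Set (Matrix (Fin N) (Fin N) (w.1.adicCompletion L)), V ∈ 𝓝 (0 : Matrix (Fin N) (Fin N) (w.1.adicCompletion L)) ∧
      ∃ T : (↥(lieOfForm (galAdicCompletionMap (L := L) (IsCMField.complexConj L) hw) (UnitaryGroup.placeForm H w.1)) → ℂ) → ℂ,
        ((∀ f₁ f₂ : ↥(lieOfForm (galAdicCompletionMap (L := L) (IsCMField.complexConj L) hw) (UnitaryGroup.placeForm H w.1)) → ℂ, IsLocSmooth f₁ → IsLocSmooth f₂ → T (f₁ + f₂) = T f₁ + T f₂) ∧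
         (∀ (a : ℂ) (f : ↥(lieOfForm (galAdicCompletionMap (L := L) (IsCMField.complexConj L) hw) (UnitaryGroup.placeForm H w.1)) → ℂ), IsLocSmooth f → T (a • f) = a * T f) ∧
         (∀ (x : ↥(unitaryGroupOfForm (galAdicCompletionMap (L := L) (IsCMField.complexConj L) hw) (UnitaryGroup.placeForm H w.1))) (f : ↥(lieOfForm (galAdicCompletionMap (L := L) (IsCMField.complexConj L) hw) (UnitaryGroup.placeForm H w.1)) → ℂ), IsLocSmooth f →
            T (fun X => f ⟨((x : GL (Fin N) (w.1.adicCompletion L)) : Matrix (Fin N) (Fin N) (w.1.adicCompletion L)) * X.1 * (((x : GL (Fin N) (w.1.adicCompletion L))⁻¹ : GL (Fin N) (w.1.adicCompletion L)) : Matrix (Fin N) (Fin N) (w.1.adicCompletion L)),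
              conj_mem_lieOfForm x.2 X.2⟩) = T f) ∧
         (∀ f : ↥(lieOfForm (galAdicCompletionMap (L := L) (IsCMField.complexConj L) hw) (UnitaryGroup.placeForm H w.1)) → ℂ, IsLocSmooth f → (∀ X ∈ tsupport f, ¬ IsNilpotent X.1) → T f = 0)) ∧
        ∀ Fn : ↥(lieOfForm (galAdicCompletionMap (L := L) (IsCMField.complexConj L) hw) (UnitaryGroup.placeForm H w.1)) → ℂ,
          (∀ f : ↥(lieOfForm (galAdicCompletionMap (L := L) (IsCMField.complexConj L) hw) (UnitaryGroup.placeForm H w.1)) → ℂ, IsLocSmooth f → T (lieFourier (galAdicCompletionMap (L := L) (IsCMField.complexConj L) hw) (UnitaryGroup.placeForm H w.1) (fun x : w.1.adicCompletion L => ((ψ x : Circle) : ℂ)) μ𝔤 f) = ∫ X, f X * Fn X ∂μ𝔤) →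
          (∀ X : ↥(lieOfForm (galAdicCompletionMap (L := L) (IsCMField.complexConj L) hw) (UnitaryGroup.placeForm H w.1)), IsUnit X.1.charpoly.discr → ∀ᶠ Y in 𝓝 X, Fn Y = Fn X) →
          ∀ g : ↥(unitaryGroupOfForm (galAdicCompletionMap (L := L) (IsCMField.complexConj L) hw) (UnitaryGroup.placeForm H w.1)), ∀ Y : ↥(lieOfForm (galAdicCompletionMap (L := L) (IsCMField.complexConj L) hw) (UnitaryGroup.placeForm H w.1)), Y.1 ∈ V → IsUnit Y.1.charpoly.discr → IsUnit (1 - Y.1) → IsUnit (1 + Y.1) →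
            ((g : GL (Fin N) (w.1.adicCompletion L)) : Matrix (Fin N) (Fin N) (w.1.adicCompletion L)) = (1 + Y.1) * (1 - Y.1)⁻¹ → Θ₀ g = Fn Y :=
  Summit.HodgeConjecture.HodgeConjecture.Cruxes.H413.K2E3ULieCharExpansionAtOneLeOne.uLieCharExpansionAtOne_le_one

set_option maxHeartbeats 1600000 in
set_option synthInstance.maxHeartbeats 400000 in
open scoped Classical in
open MeasureTheory.Measure Filter Topology Polynomial Literature.NumberTheory.GaloisRepresentations.IsNonarchimedeanLocalField Summit.HodgeConjecture.HodgeConjecture.Cruxes.H413.K2E3LieUnitary in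
/-- **LEAF (LAU-2) `sig_K2E3ULieCharExpansionAtOneTwo`** — (L-A_U)′ AT `N = 2`: Harish-Chandra's local character expansion at `1` in `T̂`-form for `U(σ_w,H_w)(L_w)`, `H ∈ M₂(L)` hermitian non-degenerate (`U(1,1)` or anisotropic `U(2)` at a place `w ∣ v` fixed by `c`)
(= (L-A_U)′ «LIE» :401 with `N := 2`, the `subst`-image; size L–XL; no road in tree yet).
PAYER NOTE (K2E3-audit1 (g0) Q2 (5) 15:04:52Z, PASS): the socket is written in CAYLEY coordinates `g = (1+Y)(1−Y)⁻¹`; print (HC1999 Thm. 16.2–16.3 ∕ DeBacker homogeneity) uses `exp` or «any `G`-equivariant analytic chart tangent to `id` at `0`» — Cayley is such a chart (char `0`, every `p`) and the expansion holds in any such chart with the same `span{μ̂_𝒪}` (germ transport along the chart; coefficients rescale): cite the chart-independence remark when paying, do not re-derive `exp`. [cite: HarishChandra1999AdmissibleDistributions, Thm. 16.3 p. 77, §21 p. 87] [cite: Howe1974, Prop. 3]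
ED. 1 (K2E3-typ2 g0, 2026-09-04): HOSTED LEAF — statement bytes = the cut described in the module docstring, from «LIE» (L-A_U)′ :401, tree sha16 ab77c5ccccbbc4a5 (generator `mk_lieA3_ed1.py`).  OPEN (payer files `Theorems/…lean --supports stmt-HodgeConjecture-24833 --as helper`, never importing `Lines`).  ED. 3: TIED over PART «LIE3b» ED. 2 head `uLieCharExpansionAtOneTwo_of_sigs` (K2E3-typ4 (g0)).  STATE: TIED (open content = LIE3b (LAU-dist-2)). -/
theorem sig_K2E3ULieCharExpansionAtOneTwo :
    ∀ (L : Type) [Field L] [NumberField L] [IsCMField L] (H : Matrix (Fin 2) (Fin 2) L),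
      (H.map (cmConjRingHom L))ᵀ = H → H.det ≠ 0 →
      ∀ (v : HeightOneSpectrum (𝓞 ↥(maximalRealSubfield L))) (w : UnitaryGroup.PlacesOver L v) (hw : IsCMField.complexConj L • w.1 = w.1)
      (ψ : AddChar (w.1.adicCompletion L) Circle), ψ.IsContinuousNontrivial →
      (∃ a : w.1.adicCompletion L, galAdicCompletionMap (L := L) (IsCMField.complexConj L) hw a = a ∧ ψ a ≠ 1) →
      ∀ [MeasurableSpace ↥(lieOfForm (galAdicCompletionMap (L := L) (IsCMField.complexConj L) hw) (UnitaryGroup.placeForm H w.1))]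
        [BorelSpace ↥(lieOfForm (galAdicCompletionMap (L := L) (IsCMField.complexConj L) hw) (UnitaryGroup.placeForm H w.1))]
        (μ𝔤 : Measure ↥(lieOfForm (galAdicCompletionMap (L := L) (IsCMField.complexConj L) hw) (UnitaryGroup.placeForm H w.1))) [μ𝔤.IsAddHaarMeasure]
        [MeasurableSpace ↥(unitaryGroupOfForm (galAdicCompletionMap (L := L) (IsCMField.complexConj L) hw) (UnitaryGroup.placeForm H w.1))]
        [BorelSpace ↥(unitaryGroupOfForm (galAdicCompletionMap (L := L) (IsCMField.complexConj L) hw) (UnitaryGroup.placeForm H w.1))]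
        (μ₀ : Measure ↥(unitaryGroupOfForm (galAdicCompletionMap (L := L) (IsCMField.complexConj L) hw) (UnitaryGroup.placeForm H w.1))) [μ₀.IsHaarMeasure]
        (r₀ : SmoothIrrep ↥(unitaryGroupOfForm (galAdicCompletionMap (L := L) (IsCMField.complexConj L) hw) (UnitaryGroup.placeForm H w.1))), r₀.ρ.IsAdmissible →
        ∀ Θ₀ : ↥(unitaryGroupOfForm (galAdicCompletionMap (L := L) (IsCMField.complexConj L) hw) (UnitaryGroup.placeForm H w.1)) → ℂ,
        (∀ x₀ : ↥(unitaryGroupOfForm (galAdicCompletionMap (L := L) (IsCMField.complexConj L) hw) (UnitaryGroup.placeForm H w.1)),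
          IsRegularElt (x₀ : GL (Fin 2) (w.1.adicCompletion L)) → ∀ᶠ y in 𝓝 x₀, Θ₀ y = Θ₀ x₀) →
        (∀ φ₀ : ↥(unitaryGroupOfForm (galAdicCompletionMap (L := L) (IsCMField.complexConj L) hw) (UnitaryGroup.placeForm H w.1)) → ℂ,
          IsLocSmooth φ₀ → (IrrClass.mk r₀).smoothTrace μ₀ φ₀ = ∫ x, φ₀ x * Θ₀ x ∂μ₀) →
      ∃ V : Set (Matrix (Fin 2) (Fin 2) (w.1.adicCompletion L)), V ∈ 𝓝 (0 : Matrix (Fin 2) (Fin 2) (w.1.adicCompletion L)) ∧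
      ∃ T : (↥(lieOfForm (galAdicCompletionMap (L := L) (IsCMField.complexConj L) hw) (UnitaryGroup.placeForm H w.1)) → ℂ) → ℂ,
        ((∀ f₁ f₂ : ↥(lieOfForm (galAdicCompletionMap (L := L) (IsCMField.complexConj L) hw) (UnitaryGroup.placeForm H w.1)) → ℂ, IsLocSmooth f₁ → IsLocSmooth f₂ → T (f₁ + f₂) = T f₁ + T f₂) ∧
         (∀ (a : ℂ) (f : ↥(lieOfForm (galAdicCompletionMap (L := L) (IsCMField.complexConj L) hw) (UnitaryGroup.placeForm H w.1)) → ℂ), IsLocSmooth f → T (a • f) = a * T f) ∧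
         (∀ (x : ↥(unitaryGroupOfForm (galAdicCompletionMap (L := L) (IsCMField.complexConj L) hw) (UnitaryGroup.placeForm H w.1))) (f : ↥(lieOfForm (galAdicCompletionMap (L := L) (IsCMField.complexConj L) hw) (UnitaryGroup.placeForm H w.1)) → ℂ), IsLocSmooth f →
            T (fun X => f ⟨((x : GL (Fin 2) (w.1.adicCompletion L)) : Matrix (Fin 2) (Fin 2) (w.1.adicCompletion L)) * X.1 * (((x : GL (Fin 2) (w.1.adicCompletion L))⁻¹ : GL (Fin 2) (w.1.adicCompletion L)) : Matrix (Fin 2) (Fin 2) (w.1.adicCompletion L)),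
              conj_mem_lieOfForm x.2 X.2⟩) = T f) ∧
         (∀ f : ↥(lieOfForm (galAdicCompletionMap (L := L) (IsCMField.complexConj L) hw) (UnitaryGroup.placeForm H w.1)) → ℂ, IsLocSmooth f → (∀ X ∈ tsupport f, ¬ IsNilpotent X.1) → T f = 0)) ∧
        ∀ Fn : ↥(lieOfForm (galAdicCompletionMap (L := L) (IsCMField.complexConj L) hw) (UnitaryGroup.placeForm H w.1)) → ℂ,
          (∀ f : ↥(lieOfForm (galAdicCompletionMap (L := L) (IsCMField.complexConj L) hw) (UnitaryGroup.placeForm H w.1)) → ℂ, IsLocSmooth f → T (lieFourier (galAdicCompletionMap (L := L) (IsCMField.complexConj L) hw) (UnitaryGroup.placeForm H w.1) (fun x : w.1.adicCompletion L => ((ψ x : Circle) : ℂ)) μ𝔤 f) = ∫ X, f X * Fn X ∂μ𝔤) →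
          (∀ X : ↥(lieOfForm (galAdicCompletionMap (L := L) (IsCMField.complexConj L) hw) (UnitaryGroup.placeForm H w.1)), IsUnit X.1.charpoly.discr → ∀ᶠ Y in 𝓝 X, Fn Y = Fn X) →
          ∀ g : ↥(unitaryGroupOfForm (galAdicCompletionMap (L := L) (IsCMField.complexConj L) hw) (UnitaryGroup.placeForm H w.1)), ∀ Y : ↥(lieOfForm (galAdicCompletionMap (L := L) (IsCMField.complexConj L) hw) (UnitaryGroup.placeForm H w.1)), Y.1 ∈ V → IsUnit Y.1.charpoly.discr → IsUnit (1 - Y.1) → IsUnit (1 + Y.1) →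
            ((g : GL (Fin 2) (w.1.adicCompletion L)) : Matrix (Fin 2) (Fin 2) (w.1.adicCompletion L)) = (1 + Y.1) * (1 - Y.1)⁻¹ → Θ₀ g = Fn Y :=
  uLieCharExpansionAtOneTwo_of_sigs

set_option maxHeartbeats 1600000 in
set_option synthInstance.maxHeartbeats 400000 in
open scoped Classical in
open MeasureTheory.Measure Filter Topology Polynomial Literature.NumberTheory.GaloisRepresentations.IsNonarchimedeanLocalField Summit.HodgeConjecture.HodgeConjecture.Cruxes.H413.K2E3LieUnitary in
/-- **LEAF (LAU-3) `sig_K2E3ULieCharExpansionAtOneThree`** — (L-A_U)′ AT `N = 3`: Harish-Chandra's local character expansion at `1` in `T̂`-form for `U(σ_w,H_w)(L_w)`, `H ∈ M₃(L)` (Rogawski's `U(3)` ∕ `U(2,1)`)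
(= (L-A_U)′ «LIE» :401 with `N := 3`; the ONE rank-two instance on the `stub_StCharTS` cone; size XL; no road in tree yet).
PAYER NOTE (K2E3-audit1 (g0) Q2 (5) 15:04:52Z, PASS): the socket is written in CAYLEY coordinates `g = (1+Y)(1−Y)⁻¹`; print (HC1999 Thm. 16.2–16.3 ∕ DeBacker homogeneity) uses `exp` or «any `G`-equivariant analytic chart tangent to `id` at `0`» — Cayley is such a chart (char `0`, every `p`) and the expansion holds in any such chart with the same `span{μ̂_𝒪}` (germ transport along the chart; coefficients rescale): cite the chart-independence remark when paying, do not re-derive `exp`. [cite: HarishChandra1999AdmissibleDistributions, Thm. 16.3 p. 77, §21 p. 87] [cite: Howe1974, Prop. 3]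
ED. 1 (K2E3-typ2 g0, 2026-09-04): HOSTED LEAF — statement bytes = the cut described in the module docstring, from «LIE» (L-A_U)′ :401, tree sha16 ab77c5ccccbbc4a5 (generator `mk_lieA3_ed1.py`).  OPEN (payer files `Theorems/…lean --supports stmt-HodgeConjecture-24833 --as helper`, never importing `Lines`).  ED. 3: TIED over PART «LIE3b» ED. 2 head `uLieCharExpansionAtOneThree_of_sigs` (K2E3-typ4 (g0)).  STATE: TIED (open content = LIE3b (LAU-dist-3)). -/
theorem sig_K2E3ULieCharExpansionAtOneThree :
    ∀ (L : Type) [Field L] [NumberField L] [IsCMField L] (H : Matrix (Fin 3) (Fin 3) L),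
      (H.map (cmConjRingHom L))ᵀ = H → H.det ≠ 0 →
      ∀ (v : HeightOneSpectrum (𝓞 ↥(maximalRealSubfield L))) (w : UnitaryGroup.PlacesOver L v) (hw : IsCMField.complexConj L • w.1 = w.1)
      (ψ : AddChar (w.1.adicCompletion L) Circle), ψ.IsContinuousNontrivial →
      (∃ a : w.1.adicCompletion L, galAdicCompletionMap (L := L) (IsCMField.complexConj L) hw a = a ∧ ψ a ≠ 1) →
      ∀ [MeasurableSpace ↥(lieOfForm (galAdicCompletionMap (L := L) (IsCMField.complexConj L) hw) (UnitaryGroup.placeForm H w.1))]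
        [BorelSpace ↥(lieOfForm (galAdicCompletionMap (L := L) (IsCMField.complexConj L) hw) (UnitaryGroup.placeForm H w.1))]
        (μ𝔤 : Measure ↥(lieOfForm (galAdicCompletionMap (L := L) (IsCMField.complexConj L) hw) (UnitaryGroup.placeForm H w.1))) [μ𝔤.IsAddHaarMeasure]
        [MeasurableSpace ↥(unitaryGroupOfForm (galAdicCompletionMap (L := L) (IsCMField.complexConj L) hw) (UnitaryGroup.placeForm H w.1))]
        [BorelSpace ↥(unitaryGroupOfForm (galAdicCompletionMap (L := L) (IsCMField.complexConj L) hw) (UnitaryGroup.placeForm H w.1))]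
        (μ₀ : Measure ↥(unitaryGroupOfForm (galAdicCompletionMap (L := L) (IsCMField.complexConj L) hw) (UnitaryGroup.placeForm H w.1))) [μ₀.IsHaarMeasure]
        (r₀ : SmoothIrrep ↥(unitaryGroupOfForm (galAdicCompletionMap (L := L) (IsCMField.complexConj L) hw) (UnitaryGroup.placeForm H w.1))), r₀.ρ.IsAdmissible →
        ∀ Θ₀ : ↥(unitaryGroupOfForm (galAdicCompletionMap (L := L) (IsCMField.complexConj L) hw) (UnitaryGroup.placeForm H w.1)) → ℂ,
        (∀ x₀ : ↥(unitaryGroupOfForm (galAdicCompletionMap (L := L) (IsCMField.complexConj L) hw) (UnitaryGroup.placeForm H w.1)),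
          IsRegularElt (x₀ : GL (Fin 3) (w.1.adicCompletion L)) → ∀ᶠ y in 𝓝 x₀, Θ₀ y = Θ₀ x₀) →
        (∀ φ₀ : ↥(unitaryGroupOfForm (galAdicCompletionMap (L := L) (IsCMField.complexConj L) hw) (UnitaryGroup.placeForm H w.1)) → ℂ,
          IsLocSmooth φ₀ → (IrrClass.mk r₀).smoothTrace μ₀ φ₀ = ∫ x, φ₀ x * Θ₀ x ∂μ₀) →
      ∃ V : Set (Matrix (Fin 3) (Fin 3) (w.1.adicCompletion L)), V ∈ 𝓝 (0 : Matrix (Fin 3) (Fin 3) (w.1.adicCompletion L)) ∧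
      ∃ T : (↥(lieOfForm (galAdicCompletionMap (L := L) (IsCMField.complexConj L) hw) (UnitaryGroup.placeForm H w.1)) → ℂ) → ℂ,
        ((∀ f₁ f₂ : ↥(lieOfForm (galAdicCompletionMap (L := L) (IsCMField.complexConj L) hw) (UnitaryGroup.placeForm H w.1)) → ℂ, IsLocSmooth f₁ → IsLocSmooth f₂ → T (f₁ + f₂) = T f₁ + T f₂) ∧
         (∀ (a : ℂ) (f : ↥(lieOfForm (galAdicCompletionMap (L := L) (IsCMField.complexConj L) hw) (UnitaryGroup.placeForm H w.1)) → ℂ), IsLocSmooth f → T (a • f) = a * T f) ∧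
         (∀ (x : ↥(unitaryGroupOfForm (galAdicCompletionMap (L := L) (IsCMField.complexConj L) hw) (UnitaryGroup.placeForm H w.1))) (f : ↥(lieOfForm (galAdicCompletionMap (L := L) (IsCMField.complexConj L) hw) (UnitaryGroup.placeForm H w.1)) → ℂ), IsLocSmooth f →
            T (fun X => f ⟨((x : GL (Fin 3) (w.1.adicCompletion L)) : Matrix (Fin 3) (Fin 3) (w.1.adicCompletion L)) * X.1 * (((x : GL (Fin 3) (w.1.adicCompletion L))⁻¹ : GL (Fin 3) (w.1.adicCompletion L)) : Matrix (Fin 3) (Fin 3) (w.1.adicCompletion L)),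
              conj_mem_lieOfForm x.2 X.2⟩) = T f) ∧
         (∀ f : ↥(lieOfForm (galAdicCompletionMap (L := L) (IsCMField.complexConj L) hw) (UnitaryGroup.placeForm H w.1)) → ℂ, IsLocSmooth f → (∀ X ∈ tsupport f, ¬ IsNilpotent X.1) → T f = 0)) ∧
        ∀ Fn : ↥(lieOfForm (galAdicCompletionMap (L := L) (IsCMField.complexConj L) hw) (UnitaryGroup.placeForm H w.1)) → ℂ,
          (∀ f : ↥(lieOfForm (galAdicCompletionMap (L := L) (IsCMField.complexConj L) hw) (UnitaryGroup.placeForm H w.1)) → ℂ, IsLocSmooth f → T (lieFourier (galAdicCompletionMap (L := L) (IsCMField.complexConj L) hw) (UnitaryGroup.placeForm H w.1) (fun x : w.1.adicCompletion L => ((ψ x : Circle) : ℂ)) μ𝔤 f) = ∫ X, f X * Fn X ∂μ𝔤) →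
          (∀ X : ↥(lieOfForm (galAdicCompletionMap (L := L) (IsCMField.complexConj L) hw) (UnitaryGroup.placeForm H w.1)), IsUnit X.1.charpoly.discr → ∀ᶠ Y in 𝓝 X, Fn Y = Fn X) →
          ∀ g : ↥(unitaryGroupOfForm (galAdicCompletionMap (L := L) (IsCMField.complexConj L) hw) (UnitaryGroup.placeForm H w.1)), ∀ Y : ↥(lieOfForm (galAdicCompletionMap (L := L) (IsCMField.complexConj L) hw) (UnitaryGroup.placeForm H w.1)), Y.1 ∈ V → IsUnit Y.1.charpoly.discr → IsUnit (1 - Y.1) → IsUnit (1 + Y.1) →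
            ((g : GL (Fin 3) (w.1.adicCompletion L)) : Matrix (Fin 3) (Fin 3) (w.1.adicCompletion L)) = (1 + Y.1) * (1 - Y.1)⁻¹ → Θ₀ g = Fn Y :=
  uLieCharExpansionAtOneThree_of_sigs

set_option maxHeartbeats 1600000 in
set_option synthInstance.maxHeartbeats 400000 in
open scoped Classical in
open MeasureTheory.Measure Filter Topology Polynomial Literature.NumberTheory.GaloisRepresentations.IsNonarchimedeanLocalField Summit.HodgeConjecture.HodgeConjecture.Cruxes.H413.K2E3LieUnitary in
/-- **LEAF (LAU-ge4) `sig_K2E3ULieCharExpansionAtOneGeFour`** — (L-A_U)′ FOR `N ≥ 4` (= (L-A_U)′ «LIE» :401 text under `4 ≤ N`, single binder edit; size XL; NO kernel road; GENERALITY: the tier-0 organ instantiates (L-A_U)′ only at `N ≤ 3`, so this remainder has no consumer on the `stub_StCharTS` cone; count-neutral residue). [cite: HarishChandra1999AdmissibleDistributions, Thm. 16.3 p. 77, §21 p. 87] [cite: Howe1974, Prop. 3]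
ED. 1 (K2E3-typ2 g0, 2026-09-04): HOSTED LEAF — statement bytes = the cut described in the module docstring, from «LIE» (L-A_U)′ :401, tree sha16 ab77c5ccccbbc4a5 (generator `mk_lieA3_ed1.py`).  OPEN (payer files `Theorems/…lean --supports stmt-HodgeConjecture-24833 --as helper`, never importing `Lines`).  STATE: OPEN. -/
theorem sig_K2E3ULieCharExpansionAtOneGeFour :
    ∀ (L : Type) [Field L] [NumberField L] [IsCMField L] (N : ℕ), 4 ≤ N → ∀ (H : Matrix (Fin N) (Fin N) L),
      (H.map (cmConjRingHom L))ᵀ = H → H.det ≠ 0 →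
      ∀ (v : HeightOneSpectrum (𝓞 ↥(maximalRealSubfield L))) (w : UnitaryGroup.PlacesOver L v) (hw : IsCMField.complexConj L • w.1 = w.1)
      (ψ : AddChar (w.1.adicCompletion L) Circle), ψ.IsContinuousNontrivial →
      (∃ a : w.1.adicCompletion L, galAdicCompletionMap (L := L) (IsCMField.complexConj L) hw a = a ∧ ψ a ≠ 1) →
      ∀ [MeasurableSpace ↥(lieOfForm (galAdicCompletionMap (L := L) (IsCMField.complexConj L) hw) (UnitaryGroup.placeForm H w.1))]
        [BorelSpace ↥(lieOfForm (galAdicCompletionMap (L := L) (IsCMField.complexConj L) hw) (UnitaryGroup.placeForm H w.1))]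
        (μ𝔤 : Measure ↥(lieOfForm (galAdicCompletionMap (L := L) (IsCMField.complexConj L) hw) (UnitaryGroup.placeForm H w.1))) [μ𝔤.IsAddHaarMeasure]
        [MeasurableSpace ↥(unitaryGroupOfForm (galAdicCompletionMap (L := L) (IsCMField.complexConj L) hw) (UnitaryGroup.placeForm H w.1))]
        [BorelSpace ↥(unitaryGroupOfForm (galAdicCompletionMap (L := L) (IsCMField.complexConj L) hw) (UnitaryGroup.placeForm H w.1))]
        (μ₀ : Measure ↥(unitaryGroupOfForm (galAdicCompletionMap (L := L) (IsCMField.complexConj L) hw) (UnitaryGroup.placeForm H w.1))) [μ₀.IsHaarMeasure]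
        (r₀ : SmoothIrrep ↥(unitaryGroupOfForm (galAdicCompletionMap (L := L) (IsCMField.complexConj L) hw) (UnitaryGroup.placeForm H w.1))), r₀.ρ.IsAdmissible →
        ∀ Θ₀ : ↥(unitaryGroupOfForm (galAdicCompletionMap (L := L) (IsCMField.complexConj L) hw) (UnitaryGroup.placeForm H w.1)) → ℂ,
        (∀ x₀ : ↥(unitaryGroupOfForm (galAdicCompletionMap (L := L) (IsCMField.complexConj L) hw) (UnitaryGroup.placeForm H w.1)),
          IsRegularElt (x₀ : GL (Fin N) (w.1.adicCompletion L)) → ∀ᶠ y in 𝓝 x₀, Θ₀ y = Θ₀ x₀) →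
        (∀ φ₀ : ↥(unitaryGroupOfForm (galAdicCompletionMap (L := L) (IsCMField.complexConj L) hw) (UnitaryGroup.placeForm H w.1)) → ℂ,
          IsLocSmooth φ₀ → (IrrClass.mk r₀).smoothTrace μ₀ φ₀ = ∫ x, φ₀ x * Θ₀ x ∂μ₀) →
      ∃ V : Set (Matrix (Fin N) (Fin N) (w.1.adicCompletion L)), V ∈ 𝓝 (0 : Matrix (Fin N) (Fin N) (w.1.adicCompletion L)) ∧
      ∃ T : (↥(lieOfForm (galAdicCompletionMap (L := L) (IsCMField.complexConj L) hw) (UnitaryGroup.placeForm H w.1)) → ℂ) → ℂ,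
        ((∀ f₁ f₂ : ↥(lieOfForm (galAdicCompletionMap (L := L) (IsCMField.complexConj L) hw) (UnitaryGroup.placeForm H w.1)) → ℂ, IsLocSmooth f₁ → IsLocSmooth f₂ → T (f₁ + f₂) = T f₁ + T f₂) ∧
         (∀ (a : ℂ) (f : ↥(lieOfForm (galAdicCompletionMap (L := L) (IsCMField.complexConj L) hw) (UnitaryGroup.placeForm H w.1)) → ℂ), IsLocSmooth f → T (a • f) = a * T f) ∧
         (∀ (x : ↥(unitaryGroupOfForm (galAdicCompletionMap (L := L) (IsCMField.complexConj L) hw) (UnitaryGroup.placeForm H w.1))) (f : ↥(lieOfForm (galAdicCompletionMap (L := L) (IsCMField.complexConj L) hw) (UnitaryGroup.placeForm H w.1)) → ℂ), IsLocSmooth f →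
            T (fun X => f ⟨((x : GL (Fin N) (w.1.adicCompletion L)) : Matrix (Fin N) (Fin N) (w.1.adicCompletion L)) * X.1 * (((x : GL (Fin N) (w.1.adicCompletion L))⁻¹ : GL (Fin N) (w.1.adicCompletion L)) : Matrix (Fin N) (Fin N) (w.1.adicCompletion L)),
              conj_mem_lieOfForm x.2 X.2⟩) = T f) ∧
         (∀ f : ↥(lieOfForm (galAdicCompletionMap (L := L) (IsCMField.complexConj L) hw) (UnitaryGroup.placeForm H w.1)) → ℂ, IsLocSmooth f → (∀ X ∈ tsupport f, ¬ IsNilpotent X.1) → T f = 0)) ∧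
        ∀ Fn : ↥(lieOfForm (galAdicCompletionMap (L := L) (IsCMField.complexConj L) hw) (UnitaryGroup.placeForm H w.1)) → ℂ,
          (∀ f : ↥(lieOfForm (galAdicCompletionMap (L := L) (IsCMField.complexConj L) hw) (UnitaryGroup.placeForm H w.1)) → ℂ, IsLocSmooth f → T (lieFourier (galAdicCompletionMap (L := L) (IsCMField.complexConj L) hw) (UnitaryGroup.placeForm H w.1) (fun x : w.1.adicCompletion L => ((ψ x : Circle) : ℂ)) μ𝔤 f) = ∫ X, f X * Fn X ∂μ𝔤) →
          (∀ X : ↥(lieOfForm (galAdicCompletionMap (L := L) (IsCMField.complexConj L) hw) (UnitaryGroup.placeForm H w.1)), IsUnit X.1.charpoly.discr → ∀ᶠ Y in 𝓝 X, Fn Y = Fn X) →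
          ∀ g : ↥(unitaryGroupOfForm (galAdicCompletionMap (L := L) (IsCMField.complexConj L) hw) (UnitaryGroup.placeForm H w.1)), ∀ Y : ↥(lieOfForm (galAdicCompletionMap (L := L) (IsCMField.complexConj L) hw) (UnitaryGroup.placeForm H w.1)), Y.1 ∈ V → IsUnit Y.1.charpoly.discr → IsUnit (1 - Y.1) → IsUnit (1 + Y.1) →
            ((g : GL (Fin N) (w.1.adicCompletion L)) : Matrix (Fin N) (Fin N) (w.1.adicCompletion L)) = (1 + Y.1) * (1 - Y.1)⁻¹ → Θ₀ g = Fn Y := by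
  sorry

end Summit.HodgeConjecture.HodgeConjecture.Cruxes.H413.K2E3EllipticInputs.U12Characters

end
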